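import Summits.QuantumFields.BalabanUV.T4Continuum.Spine.NE3.RemainderL1OneLevelB8
import Summits.QuantumFields.BalabanUV.T4Continuum.Support.NE3CovariantLineSumsL2TowerSharp
import HarnessLib

/-!
# T⁴ programme, node NE3 — census R26′, step 2c-β: THE ℓ¹ TOWER OF THE LINEARISED AVERAGE — `dirL1 (QbarIter L (j+1) W Y) (periodBox N) ≤ 2·(L∕L^d)^{j+1}·dirL1 Y`
# under ONE displayed level-sum line (the ℓ¹ twin of `NE3CovariantLineSumsL2Tower`)

Cell `pub-balaban-gaps` (YM blitz, track G2, seat `ne3`, unit `pub-balaban-gaps-ne3`; writer prover-pub-balaban-gaps-ne3-g4-0, 2026-08-23), census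
`run/shared/lean/pub/pub-balaban-gaps/ne/NE3.md` §4 R26′ ∕ §10 F8.  The ℓ¹ propagation with a NON-COMPOUNDING constant is the one input the QUADRATIC ℓ¹ size
`dirL1 φ ≲ M^{2−d}·dirSq Z` (hence the ℓ¹-curl letter of the normal part WITHOUT the Π-REG majorant) was waiting for.  THIS FILE mirrors C1 file 5
(`NE3CovariantLineSumsL2Tower.sqrt_l2sq_QstrIter_le` ∕ `sqrt_l2sq_ErrIter_le`) in ℓ¹: straight weight `r₁ = L∕L^d` (EXACT, `RemainderL1OneLevelB8.dirL1_Qstr_le`), defect weight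
`K₁·x` with `K₁ = 16(d+1)(d+4)L²·Csup·d·(2·nbRad+1)^d` (`dirL1_Dstr_le`), level sum `K₁·radSum d L j x`; the induction of the error recursion
`ErrIter (j+1) = ErrIter j ∘ Qstr + QbarIter j ∘ Dstr` closes under the DISPLAYED line `K₁·radSum d L j x ≤ r₁∕2` (k-free but, with the crude box count, NOT a theorem of
`LevelSmall` — the sharp local ℓ¹ weight of `NE3CovariantLineSumsL2Sharp`'s kind would remove it; said, not done).

CONTENT (all [folklore]; 0 sorry; 0 def): `dirL1_QstrIter_le` (`≤ r₁^{j+1}·dirL1 Y`), **`dirL1_ErrIter_le`** (`≤ 2·(K₁·radSum)·r₁^j·dirL1 Y`), **`dirL1_QbarIter_le`**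
(`≤ 2·r₁^{j+1}·dirL1 Y` under the line).

HONEST FRAMING.  Covariant kinematics on OUR frame; the final quadratic `dirL1 φ` bound and the supplier re-wired WITHOUT Π-REG (steps 2c-γ∕2d) are NOT here; NOTHING of Bałaban's is
proved; **NE3 is NOT proved**; spine PROVED 0∕9; finite T⁴ rung (B)+1 — NOT continuum YM on ℝ⁴, NOT infinite volume, NOT mass gap, NOT `BetaPertH`, NOT Clay.  PLACEMENT:
`Summits/QuantumFields/BalabanUV/T4Continuum/Spine/NE3/`.
-/

set_option autoImplicit false

open scoped BigOperators Matrix.Norms.L2Operator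
open Finset

namespace Summit.QuantumFields.BalabanUV.T4Continuum.NE3.RemainderL1TowerB8

open Literature.MathematicalPhysics.QuantumFieldTheory.Balaban1983to89
open B7Prop1Explicit B7Prop2Explicit
open T4AveragingDeficitWall (IsUnitaryCfg SmallField dirL1)
open T4AveragingDeficitWallBoundary (IsPeriodicCfg periodBox)
open AveragingDeficitPeriodicCounting (IsPeriodicDir)
open AveragingDeficitChartCalculus (cavg)
open AveragingDeficitTwoLevelPrep (prop1Radius)
open AveragingDeficitMultiLevelPrep (tower LevelSmall radIter prop1Radius_nonneg)
open BlockAverageVaryHolo (nbRad)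
open NE3TangentCovariantTower (QbarIter step_small)
open NE3CovariantLineSums (Qstr)
open NE3CovariantLineSumsTower (Dstr QstrIter ErrIter ErrIter_succ ErrIter_zero QstrIter_succ QstrIter_zero QbarIter_eq_QstrIter_add_ErrIter)
open NE3CovariantLineSumsError (Csup Csup_nonneg)
open NE3CovariantLineSumsL2Tower (periodic_step)
open ReplicationRightInverseBound (radSum radSum_nonneg)
open NE3.RemainderL1OneLevelB8 (dirL1_Qstr_le dirL1_Dstr_le)

noncomputable section

variable {d : ℕ} {n : Type*} [Fintype n] [DecidableEq n]

/-- `dirL1 ≥ 0`. [folklore] -/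
theorem dirL1_nonneg' (Y : Site d → Fin d → Matrix n n ℂ) (F : Finset (Site d)) : 0 ≤ dirL1 Y F := by
  unfold dirL1; positivity

/-- Triangle for `dirL1` in the pointwise-sum form. [folklore] -/
theorem dirL1_add_le' (f g : Site d → Fin d → Matrix n n ℂ) (F : Finset (Site d)) :
    dirL1 (fun z κ => f z κ + g z κ) F ≤ dirL1 f F + dirL1 g F := by
  unfold dirL1
  rw [← Finset.sum_add_distrib]
  refine Finset.sum_le_sum fun x _ => ?_
  rw [← Finset.sum_add_distrib]
  exact Finset.sum_le_sum fun κ _ => norm_add_le _ _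

/-! ## §1 The straight tower in ℓ¹ (exact weight) -/

/-- **THE STRAIGHT TOWER IN ℓ¹**: `dirL1 (QstrIter L (j+1) W Y) (periodBox N) ≤ (L∕L^d)^{j+1}·dirL1 Y (periodBox (tower L N (j+1)))` in the multi-level small-field class.
[folklore] -/
theorem dirL1_QstrIter_le [Nonempty n] {L N : ℕ} (hL : 1 ≤ L) (hN : 1 ≤ N) (j : ℕ) :
    ∀ {W : Site d → Fin d → (Matrix n n ℂ)ˣ} {x : ℝ}, IsUnitaryCfg W → IsPeriodicCfg W ((tower L N (j + 1) : ℕ) : ℤ) → 0 ≤ x →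
    LevelSmall d L j x → SmallField W x → ∀ {Y : Site d → Fin d → Matrix n n ℂ}, IsPeriodicDir Y ((tower L N (j + 1) : ℕ) : ℤ) →
      dirL1 (QstrIter L (j + 1) W Y) (periodBox (d := d) N)
        ≤ ((L : ℝ) / (L : ℝ) ^ d) ^ (j + 1) * dirL1 Y (periodBox (d := d) (tower L N (j + 1))) := by
  induction j with
  | zero =>
      intro W x hWu hWP hx hsm hWx Y hYP
      obtain ⟨h512, -, -, -⟩ := step_small hL hWu hx hsm hWx
      obtain ⟨-, -, hYP'', -, -, -⟩ := periodic_step (d := d) hWP hYP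
      rw [zero_add, pow_one, QstrIter_succ, QstrIter_zero]
      have h := dirL1_Qstr_le hL hN hWu hx h512 hWx (N' := N) (by simpa [tower] using hYP'')
      simpa [tower] using h
  | succ j ih =>
      intro W x hWu hWP hx hsm hWx Y hYP
      obtain ⟨h512, hW₁u, hr0, hW₁x⟩ := step_small hL hWu hx hsm.1 hWx
      obtain ⟨-, -, hYP'', hW₁P, hQP, -⟩ := periodic_step (d := d) hWP hYP
      rw [QstrIter_succ]
      have hT1 : 1 ≤ tower L N (j + 1) := Nat.one_le_iff_ne_zero.mpr (by
        haveI : NeZero L := ⟨by omega⟩; haveI : NeZero N := ⟨by omega⟩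
        exact AveragingDeficitMultiLevelPrep.tower_ne_zero L N (j + 1))
      have h1 := ih hW₁u hW₁P hr0 hsm.2 hW₁x hQP
      have h2 := dirL1_Qstr_le hL hT1 hWu hx h512 hWx (N' := tower L N (j + 1)) hYP''
      have hr : 0 ≤ (L : ℝ) / (L : ℝ) ^ d := by positivity
      calc dirL1 (QstrIter L (j + 1) (cavg L W) (Qstr L W Y)) (periodBox (d := d) N)
          ≤ ((L : ℝ) / (L : ℝ) ^ d) ^ (j + 1) * dirL1 (Qstr L W Y) (periodBox (d := d) (tower L N (j + 1))) := h1
        _ ≤ ((L : ℝ) / (L : ℝ) ^ d) ^ (j + 1) * (((L : ℝ) / (L : ℝ) ^ d) * dirL1 Y (periodBox (d := d) (L * tower L N (j + 1)))) :=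
            mul_le_mul_of_nonneg_left h2 (by positivity)
        _ = ((L : ℝ) / (L : ℝ) ^ d) ^ (j + 1 + 1) * dirL1 Y (periodBox (d := d) (tower L N (j + 1 + 1))) := by
            rw [show (tower L N (j + 1 + 1)) = L * tower L N (j + 1) from rfl]; ring

/-! ## §2 The accumulated error in ℓ¹ -/

/-- **THE k-LEVEL ERROR IN ℓ¹(TORUS)** under the displayed level-sum line `K₁·radSum d L j x ≤ r₁∕2` (`r₁ = L∕L^d`, `K₁ = 16(d+1)(d+4)L²·Csup·d·(2·nbRad+1)^d`):
`dirL1 (ErrIter L (j+1) W Y) (periodBox N) ≤ 2·(K₁·radSum d L j x)·r₁^j·dirL1 Y (periodBox (tower L N (j+1)))`. [folklore] -/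
theorem dirL1_ErrIter_le [Nonempty n] {L N : ℕ} (hL : 1 ≤ L) (hN : 1 ≤ N) (j : ℕ) :
    ∀ {W : Site d → Fin d → (Matrix n n ℂ)ˣ} {x : ℝ}, IsUnitaryCfg W → IsPeriodicCfg W ((tower L N (j + 1) : ℕ) : ℤ) → 0 ≤ x →
    LevelSmall d L j x → SmallField W x →
    (16 * (d + 1) * (d + 4) * (L : ℝ) ^ 2 * Csup d L * (d * (2 * nbRad d L + 1) ^ d)) * radSum d L j x ≤ ((L : ℝ) / (L : ℝ) ^ d) / 2 →
    ∀ {Y : Site d → Fin d → Matrix n n ℂ}, IsPeriodicDir Y ((tower L N (j + 1) : ℕ) : ℤ) →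
      dirL1 (ErrIter L (j + 1) W Y) (periodBox (d := d) N)
        ≤ 2 * ((16 * (d + 1) * (d + 4) * (L : ℝ) ^ 2 * Csup d L * (d * (2 * nbRad d L + 1) ^ d)) * radSum d L j x)
            * ((L : ℝ) / (L : ℝ) ^ d) ^ j * dirL1 Y (periodBox (d := d) (tower L N (j + 1))) := by
  -- abbreviations (as plain facts; the statement keeps them explicit)
  have hCs := Csup_nonneg d L
  induction j with
  | zero =>
      intro W x hWu hWP hx hsm hWx _ Y hYP
      obtain ⟨h512, -, -, -⟩ := step_small hL hWu hx hsm hWx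
      obtain ⟨-, -, hYP'', -, -, -⟩ := periodic_step (d := d) hWP hYP
      have hE : ErrIter L (0 + 1) W Y = Dstr L W Y := by
        rw [zero_add, ErrIter_succ]; funext z κ; simp [ErrIter_zero, NE3TangentCovariantTower.QbarIter_zero]
      rw [hE]
      have h := dirL1_Dstr_le hL hN hWu hx h512 hWx (N' := N) (by simpa [tower] using hYP'')
      have h' : dirL1 (Dstr L W Y) (periodBox (d := d) N)
          ≤ 16 * (d + 1) * (d + 4) * (L : ℝ) ^ 2 * x * Csup d L * (d * (2 * nbRad d L + 1) ^ d) * dirL1 Y (periodBox (d := d) (tower L N (0 + 1))) := by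
        simpa [tower] using h
      rw [show radSum d L 0 x = x from rfl, pow_zero, mul_one]
      have hq : 0 ≤ dirL1 Y (periodBox (d := d) (tower L N (0 + 1))) := dirL1_nonneg' _ _
      have hK0 : 0 ≤ 16 * (d + 1) * (d + 4) * (L : ℝ) ^ 2 * Csup d L * (d * (2 * nbRad d L + 1) ^ d) * x := by positivity
      have e : 16 * (d + 1) * (d + 4) * (L : ℝ) ^ 2 * x * Csup d L * (d * (2 * nbRad d L + 1) ^ d)
          = 16 * (d + 1) * (d + 4) * (L : ℝ) ^ 2 * Csup d L * (d * (2 * nbRad d L + 1) ^ d) * x := by ring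
      rw [e] at h'
      nlinarith [mul_nonneg hK0 hq]
  | succ j ih =>
      intro W x hWu hWP hx hsm hWx hS Y hYP
      obtain ⟨h512, hW₁u, hr0, hW₁x⟩ := step_small hL hWu hx hsm.1 hWx
      obtain ⟨-, -, hYP'', hW₁P, hQP, hDP⟩ := periodic_step (d := d) hWP hYP
      have hT1 : 1 ≤ tower L N (j + 1) := Nat.one_le_iff_ne_zero.mpr (by
        haveI : NeZero L := ⟨by omega⟩; haveI : NeZero N := ⟨by omega⟩
        exact AveragingDeficitMultiLevelPrep.tower_ne_zero L N (j + 1))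
      set K₁ : ℝ := 16 * (d + 1) * (d + 4) * (L : ℝ) ^ 2 * Csup d L * (d * (2 * nbRad d L + 1) ^ d) with hK₁
      set r : ℝ := (L : ℝ) / (L : ℝ) ^ d with hr
      have hK₁0 : 0 ≤ K₁ := by rw [hK₁]; positivity
      have hr0' : 0 ≤ r := by rw [hr]; positivity
      -- the level sum splits: `radSum (j+1) x = x + radSum j (prop1Radius x)`
      set S' : ℝ := K₁ * radSum d L j (prop1Radius d L x) with hS'def
      have hSsplit : K₁ * radSum d L (j + 1) x = K₁ * x + S' := by
        rw [show radSum d L (j + 1) x = x + radSum d L j (prop1Radius d L x) from rfl, hS'def]; ring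
      have hδ0 : 0 ≤ K₁ * x := mul_nonneg hK₁0 hx
      have hS'0 : 0 ≤ S' := by rw [hS'def]; exact mul_nonneg hK₁0 (radSum_nonneg (d := d) (L := L) j hr0)
      have hS'le : S' ≤ r / 2 := by rw [hSsplit] at hS; linarith
      set nY : ℝ := dirL1 Y (periodBox (d := d) (tower L N (j + 1 + 1))) with hnY
      have hnY0 : 0 ≤ nY := dirL1_nonneg' _ _
      -- one-level bounds at the base
      have hQ : dirL1 (Qstr L W Y) (periodBox (d := d) (tower L N (j + 1))) ≤ r * nY :=
        dirL1_Qstr_le hL hT1 hWu hx h512 hWx (N' := tower L N (j + 1)) hYP''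
      have hD : dirL1 (Dstr L W Y) (periodBox (d := d) (tower L N (j + 1))) ≤ K₁ * x * nY := by
        have h := dirL1_Dstr_le hL hT1 hWu hx h512 hWx (N' := tower L N (j + 1)) hYP''
        have e : 16 * (d + 1) * (d + 4) * (L : ℝ) ^ 2 * x * Csup d L * (d * (2 * nbRad d L + 1) ^ d) = K₁ * x := by rw [hK₁]; ring
        rw [e] at h; exact h
      -- first term: IH at W₁ on `Qstr W Y`
      have h1 := ih hW₁u hW₁P hr0 hsm.2 hW₁x hS'le hQP
      -- second term: `QbarIter = QstrIter + ErrIter` at W₁ on `Dstr W Y`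
      have h2a := dirL1_QstrIter_le hL hN j hW₁u hW₁P hr0 hsm.2 hW₁x hDP
      have h2b := ih hW₁u hW₁P hr0 hsm.2 hW₁x hS'le hDP
      have h2 : dirL1 (QbarIter L (j + 1) (cavg L W) (Dstr L W Y)) (periodBox (d := d) N)
          ≤ r ^ (j + 1) * (K₁ * x * nY) + 2 * S' * r ^ j * (K₁ * x * nY) := by
        rw [QbarIter_eq_QstrIter_add_ErrIter hL j hW₁u hr0 hsm.2 hW₁x (Dstr L W Y)]
        refine (dirL1_add_le' _ _ _).trans (add_le_add (h2a.trans ?_) (h2b.trans ?_))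
        · exact mul_le_mul_of_nonneg_left hD (by positivity)
        · exact mul_le_mul_of_nonneg_left hD (by positivity)
      have h1' : dirL1 (ErrIter L (j + 1) (cavg L W) (Qstr L W Y)) (periodBox (d := d) N)
          ≤ 2 * S' * r ^ j * (r * nY) := h1.trans (mul_le_mul_of_nonneg_left hQ (by positivity))
      rw [ErrIter_succ, hSsplit]
      refine (dirL1_add_le' _ _ _).trans ((add_le_add h1' h2).trans ?_)
      have hρj : (0 : ℝ) ≤ r ^ j := by positivity
      have key : 2 * S' * (r ^ j * (K₁ * x * nY)) ≤ r * (r ^ j * (K₁ * x * nY)) := by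
        have h2S : 2 * S' ≤ r := by linarith only [hS'le]
        exact mul_le_mul_of_nonneg_right h2S (mul_nonneg hρj (mul_nonneg hδ0 hnY0))
      have e : r ^ (j + 1) = r ^ j * r := pow_succ _ _
      rw [e]
      have e2 : 2 * S' * r ^ j * (r * nY) + (r ^ j * r * (K₁ * x * nY) + 2 * S' * r ^ j * (K₁ * x * nY))
          = 2 * (K₁ * x + S') * (r ^ j * r) * nY + (2 * S' * (r ^ j * (K₁ * x * nY)) - r * (r ^ j * (K₁ * x * nY))) := by ring
      rw [e2]
      linarith only [key]

/-! ## §3 The linearised average in ℓ¹ -/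

/-- **THE k-FOLD LINEARISED AVERAGE IN ℓ¹(TORUS)**: under the same line, `dirL1 (QbarIter L (j+1) W Y) (periodBox N) ≤ 2·(L∕L^d)^{j+1}·dirL1 Y (periodBox (tower L N (j+1)))`
(`QbarIter = QstrIter + ErrIter`, `2·(K₁·radSum)·r₁^j ≤ r₁^{j+1}`). [folklore] -/
theorem dirL1_QbarIter_le [Nonempty n] {L N : ℕ} (hL : 1 ≤ L) (hN : 1 ≤ N) (j : ℕ)
    {W : Site d → Fin d → (Matrix n n ℂ)ˣ} {x : ℝ} (hWu : IsUnitaryCfg W) (hWP : IsPeriodicCfg W ((tower L N (j + 1) : ℕ) : ℤ)) (hx : 0 ≤ x)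
    (hsm : LevelSmall d L j x) (hWx : SmallField W x)
    (hS : (16 * (d + 1) * (d + 4) * (L : ℝ) ^ 2 * Csup d L * (d * (2 * nbRad d L + 1) ^ d)) * radSum d L j x ≤ ((L : ℝ) / (L : ℝ) ^ d) / 2)
    {Y : Site d → Fin d → Matrix n n ℂ} (hYP : IsPeriodicDir Y ((tower L N (j + 1) : ℕ) : ℤ)) :
    dirL1 (QbarIter L (j + 1) W Y) (periodBox (d := d) N) ≤ 2 * ((L : ℝ) / (L : ℝ) ^ d) ^ (j + 1) * dirL1 Y (periodBox (d := d) (tower L N (j + 1))) := by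
  have h1 := dirL1_QstrIter_le hL hN j hWu hWP hx hsm hWx hYP
  have h2 := dirL1_ErrIter_le hL hN j hWu hWP hx hsm hWx hS hYP
  have hr : 0 ≤ (L : ℝ) / (L : ℝ) ^ d := by positivity
  have hq : 0 ≤ dirL1 Y (periodBox (d := d) (tower L N (j + 1))) := dirL1_nonneg' _ _
  have hK0 : 0 ≤ (16 * (d + 1) * (d + 4) * (L : ℝ) ^ 2 * Csup d L * (d * (2 * nbRad d L + 1) ^ d)) * radSum d L j x :=
    mul_nonneg (by have := Csup_nonneg d L; positivity) (radSum_nonneg (d := d) (L := L) j hx)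
  rw [QbarIter_eq_QstrIter_add_ErrIter hL j hWu hx hsm hWx Y]
  refine (dirL1_add_le' _ _ _).trans ((add_le_add h1 h2).trans ?_)
  have hρj : (0 : ℝ) ≤ ((L : ℝ) / (L : ℝ) ^ d) ^ j := by positivity
  have e : ((L : ℝ) / (L : ℝ) ^ d) ^ (j + 1) = ((L : ℝ) / (L : ℝ) ^ d) ^ j * ((L : ℝ) / (L : ℝ) ^ d) := pow_succ _ _
  rw [e]
  have h2S : 2 * ((16 * (d + 1) * (d + 4) * (L : ℝ) ^ 2 * Csup d L * (d * (2 * nbRad d L + 1) ^ d)) * radSum d L j x)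
      ≤ (L : ℝ) / (L : ℝ) ^ d := by linarith only [hS]
  have key := mul_le_mul_of_nonneg_right h2S (mul_nonneg hρj hq)
  have e2 : ((L : ℝ) / (L : ℝ) ^ d) ^ j * ((L : ℝ) / (L : ℝ) ^ d) * dirL1 Y (periodBox (d := d) (tower L N (j + 1)))
        + 2 * ((16 * (d + 1) * (d + 4) * (L : ℝ) ^ 2 * Csup d L * (d * (2 * nbRad d L + 1) ^ d)) * radSum d L j x)
          * ((L : ℝ) / (L : ℝ) ^ d) ^ j * dirL1 Y (periodBox (d := d) (tower L N (j + 1)))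
      = 2 * (((L : ℝ) / (L : ℝ) ^ d) ^ j * ((L : ℝ) / (L : ℝ) ^ d)) * dirL1 Y (periodBox (d := d) (tower L N (j + 1)))
        + (2 * ((16 * (d + 1) * (d + 4) * (L : ℝ) ^ 2 * Csup d L * (d * (2 * nbRad d L + 1) ^ d)) * radSum d L j x)
            * (((L : ℝ) / (L : ℝ) ^ d) ^ j * dirL1 Y (periodBox (d := d) (tower L N (j + 1))))
          - (L : ℝ) / (L : ℝ) ^ d * (((L : ℝ) / (L : ℝ) ^ d) ^ j * dirL1 Y (periodBox (d := d) (tower L N (j + 1))))) := by ring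
  rw [e2]
  linarith only [key]

end

end Summit.QuantumFields.BalabanUV.T4Continuum.NE3.RemainderL1TowerB8
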